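import Mathlib
import Summits.Ventures.HodgeRepro.Tier4.Target
import Summits.Ventures.HodgeRepro.Tier4.Line3.Defs
import Summits.Ventures.HodgeRepro.Tier4.Line3.BallCoordLemmas
import Summits.Ventures.HodgeRepro.Tier4.Line3.StabFiniteApi
import Summits.Ventures.HodgeRepro.Tier4.Line3.MainTermAssembly
import Summits.Ventures.HodgeRepro.Tier4.Line3.MainTermInterchange
import Summits.Ventures.HodgeRepro.Tier4.Line3.KernelIntegrable

/-!
# Tier4/Line3/ClassSumSummable — L3.6b `classSum_summable`: the class sum of the main orbit is absolutely convergent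

Blind re-derivation cell `pub-hodge-repro`, Tier 4 «PROVE THE STEP» (README §9–§10), LINE L3, seat t4-x2 (reserve
wall-breaker; L3.4 closed p668771, then the unassigned support cut L3.6b of Skeleton v0.29 (t4-plan-3 g2 S12770, census
§4), claimed on the bus S12773).

THE STATEMENT (Skeleton v0.29 L396–L404, verbatim): under the hypotheses of L3.6a (`hD`, `h2`) and L3.7's conclusion
`h7` (so `I_∞ = ∫_𝔹 kernel xm ≠ 0`), the family `c ↦ (centerCard K / stabCard (x_c)) · coefQ (x_c)` over the `Γ′`-classes
of the main orbit is summable — the absolute convergence that makes `classSum` (a `∑′`) meaningful (finding (F), S12386: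
`∑′` of a non-summable family is `0`).

THE PROOF is a by-product of t4-L3-p1's interchange module: `summable_integral_classKernel` (MainTermInterchange) gives the
summability over the sigma type `Σ c, Γ′` of `∫_D classKernel (c, g)`, hence (`Summable.sigma`, `ℂ` complete) the
summability over `c` of the inner sums `Σ′_g ∫_D classKernel (c, g)`; and per class this inner sum is EXACTLY
`(centerCard / stabCard (x_c)) · coefQ (x_c) · I_∞` (`tsum_integral_classKernel_eq`: `classKernel (c, g) =
stabCard⁻¹ · coefQ (x_c) · kernel (g • x_c)`, `tsum_integral_kernel_mulVec` (MainTermAssembly: `Σ′_g ∫_D kernel (g • x) =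
centerCard · ∫_𝔹 kernel x`, for `kernel x` integrable on the ball — `integrableOn_kernel_of_coefQ_ne_zero`
(KernelIntegrable) when `coefQ (x_c) ≠ 0`, and both sides vanish when `coefQ (x_c) = 0`), `integral_kernel_mulVec`
(KernelEquivariance: `∫_𝔹 kernel (g_c • xm) = ∫_𝔹 kernel xm`)).  Dividing by `I_∞ ≠ 0` (`h7`: its real part is positive)
gives the claim.  `hfin` (the finiteness of the stabilisers) is t4-L3-p2's `finite_stab_mainRep` through
`linearIndependent_of_ballWedge`; the binders `h02 h13` of the registered statement are not needed.

Nothing here asserts anything about the truth of (P); HC_CM is NOT proved by anyone in this repository.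
-/

set_option autoImplicit false

noncomputable section

namespace Summit.Ventures.HodgeRepro.Tier4.Line3

open Matrix MeasureTheory

namespace T4Data

variable (X : T4Data)

/-- **PER CLASS**: the sum over `Γ′` of the integrals over `D` of the class-kernel family is
`(centerCard / stabCard (x_c)) · coefQ (x_c) · ∫_𝔹 kernel xm` (both sides vanish when `coefQ (x_c) = 0`). -/
theorem tsum_integral_classKernel_eq (D : X.ThetaData) {K : X.Level} (γ : X.Tr K) (xm : X.Tuple)
    (hfin : ∀ c : X.MainClass K xm, Finite (X.Stab K (X.mainRep K xm c)))
    (hD : IsFundamentalDomainFor (ballActions X.τ₀ X.C K.1) (X.domain K))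
    (h2 : (∀ z ∈ X.domain K, Summable fun w : X.LineTuple => ‖X.summand D.Φ D.cf γ w z‖) ∧
      IntegrableOn (fun z => ∑' w : X.LineTuple, ‖X.summand D.Φ D.cf γ w z‖) (X.domain K))
    (c : X.MainClass K xm) :
    ∑' g : {g : Matrix (Fin 3) (Fin 3) X.E // g ∈ K.1}, ∫ z in X.domain K, X.classKernel D γ xm ⟨c, g⟩ z =
      ((X.centerCard K : ℂ) / (X.stabCard K (X.mainRep K xm c) : ℂ)) * X.coefQ D.cf γ (X.mainRep K xm c) *
        ∫ z in ball, X.kernel D.Φ xm z := by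
  by_cases hc : X.coefQ D.cf γ (X.mainRep K xm c) = 0
  · simp only [T4Data.classKernel, hc, mul_zero, zero_mul, integral_zero, tsum_zero]
  · have hint := X.integrableOn_kernel_of_coefQ_ne_zero D γ xm hfin hD h2 c hc
    have h1 : ∀ g : {g : Matrix (Fin 3) (Fin 3) X.E // g ∈ K.1},
        ∫ z in X.domain K, X.classKernel D γ xm ⟨c, g⟩ z =
          ((X.stabCard K (X.mainRep K xm c) : ℂ))⁻¹ * X.coefQ D.cf γ (X.mainRep K xm c) *
            ∫ z in X.domain K, X.kernel D.Φ (fun j => g.1 *ᵥ X.mainRep K xm c j) z := fun g => by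
      unfold T4Data.classKernel
      rw [integral_const_mul]
    have hk : ∫ z in ball, X.kernel D.Φ (X.mainRep K xm c) z = ∫ z in ball, X.kernel D.Φ xm z :=
      X.integral_kernel_mulVec D (X.gRep_isUnitaryOf K xm c) xm
    calc ∑' g : {g : Matrix (Fin 3) (Fin 3) X.E // g ∈ K.1}, ∫ z in X.domain K, X.classKernel D γ xm ⟨c, g⟩ z
        = ∑' g : {g : Matrix (Fin 3) (Fin 3) X.E // g ∈ K.1},
            ((X.stabCard K (X.mainRep K xm c) : ℂ))⁻¹ * X.coefQ D.cf γ (X.mainRep K xm c) *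
              ∫ z in X.domain K, X.kernel D.Φ (fun j => g.1 *ᵥ X.mainRep K xm c j) z := tsum_congr h1
      _ = ((X.stabCard K (X.mainRep K xm c) : ℂ))⁻¹ * X.coefQ D.cf γ (X.mainRep K xm c) *
            ∑' g : {g : Matrix (Fin 3) (Fin 3) X.E // g ∈ K.1},
              ∫ z in X.domain K, X.kernel D.Φ (fun j => g.1 *ᵥ X.mainRep K xm c j) z := tsum_mul_left
      _ = ((X.stabCard K (X.mainRep K xm c) : ℂ))⁻¹ * X.coefQ D.cf γ (X.mainRep K xm c) *
            ((X.centerCard K : ℂ) * ∫ z in ball, X.kernel D.Φ (X.mainRep K xm c) z) := by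
          rw [X.tsum_integral_kernel_mulVec D K hD _ hint]
      _ = _ := by
          rw [hk]
          ring

/-- **L3.6b THE CLASS SUM IS ABSOLUTELY CONVERGENT** (Skeleton v0.29 L396–L404, verbatim). -/
theorem classSum_summable (D : X.ThetaData) (xm : X.Tuple) (h02 : xm 2 = xm 0) (h13 : xm 3 = xm 1)
    (hab : X.ballCoord (xm 0) 0 * X.ballCoord (xm 1) 1 - X.ballCoord (xm 0) 1 * X.ballCoord (xm 1) 0 ≠ 0)
    (K : X.Level) (γ : X.Tr K) (hD : IsFundamentalDomainFor (ballActions X.τ₀ X.C K.1) (X.domain K))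
    (h2 : (∀ z ∈ X.domain K, Summable (fun w : X.LineTuple => ‖X.summand D.Φ D.cf γ w z‖)) ∧
      IntegrableOn (fun z => ∑' w : X.LineTuple, ‖X.summand D.Φ D.cf γ w z‖) (X.domain K))
    (h7 : IntegrableOn (fun z => X.kernel D.Φ xm z) ball ∧ 0 < (∫ z in ball, X.kernel D.Φ xm z).re) :
    Summable (fun c : X.MainClass K xm =>
      ((X.centerCard K : ℂ) / (X.stabCard K (X.mainRep K xm c) : ℂ)) * X.coefQ D.cf γ (X.mainRep K xm c)) := by
  have _h02 := h02
  have _h13 := h13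
  have hfin : ∀ c : X.MainClass K xm, Finite (X.Stab K (X.mainRep K xm c)) :=
    fun c => X.finite_stab_mainRep K xm (X.linearIndependent_of_ballWedge hab) c
  have hI : (∫ z in ball, X.kernel D.Φ xm z) ≠ 0 := by
    intro h0
    have h7' := h7.2
    rw [h0, Complex.zero_re] at h7'
    exact lt_irrefl (0 : ℝ) h7'
  have hS : Summable fun c : X.MainClass K xm =>
      ∑' g : {g : Matrix (Fin 3) (Fin 3) X.E // g ∈ K.1}, ∫ z in X.domain K, X.classKernel D γ xm ⟨c, g⟩ z :=
    (X.summable_integral_classKernel D γ xm hfin hD h2).sigma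
  have heq : (fun c : X.MainClass K xm =>
      ∑' g : {g : Matrix (Fin 3) (Fin 3) X.E // g ∈ K.1}, ∫ z in X.domain K, X.classKernel D γ xm ⟨c, g⟩ z) =
      fun c : X.MainClass K xm =>
        ((X.centerCard K : ℂ) / (X.stabCard K (X.mainRep K xm c) : ℂ)) * X.coefQ D.cf γ (X.mainRep K xm c) *
          ∫ z in ball, X.kernel D.Φ xm z :=
    funext fun c => X.tsum_integral_classKernel_eq D γ xm hfin hD h2 c
  rw [heq] at hS
  refine (hS.mul_right (∫ z in ball, X.kernel D.Φ xm z)⁻¹).congr fun c => ?_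
  rw [mul_assoc, mul_inv_cancel₀ hI, mul_one]

end T4Data

end Summit.Ventures.HodgeRepro.Tier4.Line3

end
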